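import Summits.BirchSwinnertonDyer.BirchSwinnertonDyer.Theorems.KolyvaginDepthDoorDepthTableGlobalMinimal
import Summits.BirchSwinnertonDyer.BirchSwinnertonDyer.Theorems.KolyvaginDepthDoorDepthTableKuriharaDecisivePair664a1
import Summits.BirchSwinnertonDyer.BirchSwinnertonDyer.Theorems.KolyvaginDepthDoorDepthTableKuriharaESide6
import Summits.BirchSwinnertonDyer.BirchSwinnertonDyer.Theorems.KolyvaginDepthDoorDepthTableRows3
import Summits.BirchSwinnertonDyer.BirchSwinnertonDyer.Theorems.KolyvaginDepthDoorDepthTableKuriharaESide4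
import Summits.BirchSwinnertonDyer.BirchSwinnertonDyer.Theorems.KolyvaginDepthDoorDepthTableKuriharaDecisivePairBridge
import Summits.BirchSwinnertonDyer.Rank1Residual.GaloisImage.FrobeniusOrderWitness
import HarnessLib

/-!
# Route `KolyvaginDepthDoor`, crux `KolyvaginDepthSupplyKN` (stmt-BirchSwinnertonDyer-22820) —
# DEPTH TABLE v24, RANK-TWO CURVE `664a1` @ `p = 7` (non-anomalous): ADMISSIBILITY AND REDUCTION CERTIFICATES for the recorded
# depth-two level `94361 = 127·743` (the integral model, `7` good ordinary non-anomalous,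
# `ρ̄_{E,7}` onto, Kodaira–Néron at `7`, the cyclic Kolyvagin level, the two generators and their reductions)

Helper file of the lead prover of line `levelone` (kdd-p1 g28; `--supports stmt-BirchSwinnertonDyer-22820 --as helper`);
it closes nothing and BSD is NOT proved by it. Pure kernel certificates on the literal integral model
`[0, 0, 0, -7, 10]` of `664a1` (`N = 664`, `Δ = -21248`, `c₄ = 336`, rank `2`): every numeric side condition of
the E-side reading at `(E, p, n) = (664a1, 7, 94361)`, decided in the kernel as in the v22/v23 tables: `#Ẽ(𝔽_7) = 13`
(`a_7 = -5`), `#Ẽ(𝔽_{127}) = 133`, `#Ẽ(𝔽_{743}) = 700` (each `ℓ ≡ 1`, `a_ℓ ≡ 2 (mod 7)`, cyclic `7`-part);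
surjectivity of `ρ̄_{E,7}` by Serre's Prop. 19 a) (an element of order p from a Kolyvagin prime) fed by Mazur's no-root witness at `q = 5`
(`a_5 = -4`); Kodaira–Néron from the exponent table of `Δ`. The reading itself is the sibling `…KuriharaDecisivePair664a1p7`.
BSD is NOT proved by any of this.

References: [CremonaAlgorithms1997] Table 1 (664a1); [Serre1972] §5.4 Prop. 21, §2.8 Prop. 19; [Mazur1978] §6 Prop. 6.3 (1);
[Kim2022StructureSelmer] §1.2.2, Prop. 3.2; [SilvermanAEC2009] Exercise 3.7, VII.1 Rem. 1.1, VII.5 Prop. 5.1, VIII.8.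
-/

set_option linter.dupNamespace false

noncomputable section

open scoped Classical NumberField

namespace Summit.BirchSwinnertonDyer.BirchSwinnertonDyer.Theorems.KolyvaginDepthDoor

open Literature.NumberTheory.EllipticCurves Literature.NumberTheory.EllipticCurves.ModularForms
  WeierstrassCurve NumberField IsDedekindDomain
open Summit.BirchSwinnertonDyer.BirchSwinnertonDyer.Theorems
open Summit.BirchSwinnertonDyer.BirchSwinnertonDyer.Rank2Observatory
open Summit.BirchSwinnertonDyer.BirchSwinnertonDyer.Rank1Residual (IntModel.frobeniusTrace_eq IntModel.integralModelInt_eq_of_map_eq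
  IntModel.minimalDiscriminantInt_eq)
open Summit.BirchSwinnertonDyer.Rank1Residual.Supersingular (natCard_point_eq_of_countPoints countPoints_eq_of_fast)
open Summit.BirchSwinnertonDyer.Rank1Residual.Additive (card_torsion_le_of_intModel_of_card
  isKolyvaginPrime_of_intModel_of_card isKolyvaginProduct_mul)
open Summit.BirchSwinnertonDyer.Rank1Residual.GaloisImage (hasSurjectiveModNGaloisRep_of_intModel_of_irr_of_order)

namespace C664a1

/-- **Kodaira–Néron for `664a1` at `p = 7`**: `7 ∤ ord_v(Δ_min)` at every multiplicative place `v` (`Δ_min = -21248`; the exponent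
table of `|Δ|` below `5` with `|Δ| < 5^7`, `decide`d). [cite: CremonaAlgorithms1997, Table 1 (664a1)] [cite: SilvermanAEC2009, VII.5 Prop. 5.1] -/
theorem kodairaNeron_int_7 :
    haveI := isElliptic_c664a1; haveI := isGloballyMinimal_c664a1;
    ∀ v : HeightOneSpectrum (𝓞 ℚ), ((⟨0, 0, 0, -7, 10⟩ : WeierstrassCurve ℤ).map (Int.castRingHom ℚ)).HasMultiplicativeReductionAt v → ¬ 7 ∣ ((⟨0, 0, 0, -7, 10⟩ : WeierstrassCurve ℤ).map (Int.castRingHom ℚ)).ordMinimalDiscriminant v := by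
  haveI := isElliptic_c664a1; haveI := isGloballyMinimal_c664a1
  exact not_dvd_ordMinimalDiscriminant_of_intModel_table intModel (p := 7) (Δ₀ := -21248) (by decide +kernel)
    (B := 5) (by decide +kernel) (by decide +kernel)

/-- Reduction DATA at `127` (`127 ∤ Δ`; `P̄₁ = (1, 2)`, `P̄₂ = (3, 4)`; denominators prime to `127`), kernel-decided. [folklore] -/
theorem red_127 :
    ¬ ((127 : ℕ) : ℤ) ∣ (⟨0, 0, 0, -7, 10⟩ : WeierstrassCurve ℤ).Δ ∧
    (¬ (127 : ℕ) ∣ ((1 : ℚ)).den ∧ ¬ (127 : ℕ) ∣ ((2 : ℚ)).den ∧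
      ((127 : ℕ) : ℤ) ∣ ((1 : ℚ)).num - (1 : ℤ) * ((1 : ℚ)).den ∧
      ((127 : ℕ) : ℤ) ∣ ((2 : ℚ)).num - (2 : ℤ) * ((2 : ℚ)).den) ∧
    (¬ (127 : ℕ) ∣ ((3 : ℚ)).den ∧ ¬ (127 : ℕ) ∣ ((4 : ℚ)).den ∧
      ((127 : ℕ) : ℤ) ∣ ((3 : ℚ)).num - (3 : ℤ) * ((3 : ℚ)).den ∧
      ((127 : ℕ) : ℤ) ∣ ((4 : ℚ)).num - (4 : ℤ) * ((4 : ℚ)).den) := by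
  decide +kernel

/-- `7·19 = #Ẽ(𝔽_{127})` (`card_127`). [cite: CremonaAlgorithms1997, Table 1 (664a1)] -/
theorem hpk_127 : 7 * 19 = Nat.card ((⟨0, 0, 0, -7, 10⟩ : WeierstrassCurve ℤ).map (Int.castRingHom (ZMod 127))).toAffine.Point := by
  rw [card_127]

/-- Reduction DATA at `743` (`743 ∤ Δ`; `P̄₁ = (1, 2)`, `P̄₂ = (3, 4)`; denominators prime to `743`), kernel-decided. [folklore] -/
theorem red_743 :
    ¬ ((743 : ℕ) : ℤ) ∣ (⟨0, 0, 0, -7, 10⟩ : WeierstrassCurve ℤ).Δ ∧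
    (¬ (743 : ℕ) ∣ ((1 : ℚ)).den ∧ ¬ (743 : ℕ) ∣ ((2 : ℚ)).den ∧
      ((743 : ℕ) : ℤ) ∣ ((1 : ℚ)).num - (1 : ℤ) * ((1 : ℚ)).den ∧
      ((743 : ℕ) : ℤ) ∣ ((2 : ℚ)).num - (2 : ℤ) * ((2 : ℚ)).den) ∧
    (¬ (743 : ℕ) ∣ ((3 : ℚ)).den ∧ ¬ (743 : ℕ) ∣ ((4 : ℚ)).den ∧
      ((743 : ℕ) : ℤ) ∣ ((3 : ℚ)).num - (3 : ℤ) * ((3 : ℚ)).den ∧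
      ((743 : ℕ) : ℤ) ∣ ((4 : ℚ)).num - (4 : ℤ) * ((4 : ℚ)).den) := by
  decide +kernel

/-- `7·100 = #Ẽ(𝔽_{743})` (`card_743`). [cite: CremonaAlgorithms1997, Table 1 (664a1)] -/
theorem hpk_743 : 7 * 100 = Nat.card ((⟨0, 0, 0, -7, 10⟩ : WeierstrassCurve ℤ).map (Int.castRingHom (ZMod 743))).toAffine.Point := by
  rw [card_743]

end C664a1

end Summit.BirchSwinnertonDyer.BirchSwinnertonDyer.Theorems.KolyvaginDepthDoor

end

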